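import Summits.QuantumFields.YangMills.Theorems.BalabanUVNodesN15TwoGridDressedUnitLayerLetters
import Summits.QuantumFields.YangMills.Theorems.BalabanUVNodesN15FullPropagatorC2BgUnitN15At
import Summits.QuantumFields.YangMills.Theorems.BalabanUVNodesN15TwoGridDressedLaplacianKnitN15At
import HarnessLib

/-!
# N15 (NE2) — PROGRAMME Λ-U, part Λ-F: ★★★ `NE2PlusUnit` BY NAME WITH THE BACKGROUND LIVE FOR THE PAIR OF RECORD ON THE (3.35)-PAIR CARRIER (size `M` LIVE, threshold in `α₀` ALONE),
# AND `N15At` WITH THE OPERATOR (all four (3.42) entries) AND THE UNIT LAYERS READING `U`, the family passing the K3⁸ guard `Live`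

WHO ∕ WHEN.  Cell `pub-ymgap`, seat `pub-ymgap-dag-n15-a` (KNIT-BY-NAME seat of Track-A DAG node N15 = NE2, g27); `--supports stmt-QuantumFields-27366 --as helper` (K3⁸; count-neutral).
Two plumbing `def`s (the U-seeing unit kernel `foCovBg`, the `NE2Objects₁₁` literal `allEntriesBgObjects`) + theorems.  Over Λ-E `…TwoGridDressedUnitLayerLetters` (★★★ `zOp_letters_FO`), g16's
U-A (`cov2156_rate_torus_add`, `epsCov`, `epsCov_pos`), U-B (`dressP_deltaPol_letters`, `dressP_isSymm`), U-D (`bgPert`, `covBg`, `bgPert_zero`, `rpow_pow_eq`), Λ-C (★★★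
`ne2PlusOperator_allEntries_fullG`), Λ-D (`live_foInstanceFG`), II-E (`foInstanceFG`, `coeffBgFO`, `reg335_coeffBgFO_iff`, `osc_rate_le`), S-D (`siteOnS`, `n15At_opGeoS_of_operator_unit`),
part 76 (`covDiff`), n15-b (`fibreOsc_of_fgrad`, `blockAvg_zero`), `T4EtaRateCoeffDefect.fit_blockAvg` BY NAME; nothing in the tree is modified.  PATTERN = U-D `…FullPropagatorC2BgUnitN15At`.

WHY.  U-D dressed the (2.156) unit-lattice covariance through the operator layer's own dressed propagator on dag-n15-c's primitive-carrier family — whose [B9] size is `M = 1` (it FAILS the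
K3⁸ guard `Live`) and whose (3.35) carries `∇c′`, `∇∇a′`.  With Λ-E's letters the same dressing runs on II-E's sized (3.35)-pair family `foInstanceFG` (Bałaban's `M` LIVE through
`c₃₅·M·α₀`; the guard `M·α₀ ≤ a₀` is the print's), and Λ-C∕Λ-D make the OPERATOR layer of the same family background-live in all four entries.

WHAT.  §1 def `foCovBg d hL b α β j` (`(U, y, y′) ↦ C_{P′(U)}^{(L^mL^k)}((ȳ,α),(ȳ′,β)) − C_{P(Ū)}^{(L^k)}((ȳ,α),(ȳ′,β))`, `Ū = (blockAvg c′, blockAvg a′_μ)`), `foCovBg_ker`, ★ `foCovBg_one` (at `U = 0` the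
kernel IS part 76's genuine `covDiff`); §2 ★★★ **`ne2PlusUnit_foCovBg (hd : 1 ≤ d) (hLodd) (hL3 : 3 ≤ L) (hL) (hb) (hc₃₅) (α β) : NE2PlusUnit c₃₅ (foInstanceFG d hL) (foCovBg d hL b α β) ⊤ dist`**
— constants `(δ₀, a₀, B₀, θ = L^{−γ₀})`, `γ₀ = min(1∕16, 1∕(8(d+1)))`, `a₀ = min(r₁∕c₃₅, ε_cov∕(K(|b|+1)²ζc₃₅))`: the BACKGROUND IS READ, the SIZE IS LIVE, the threshold is a smallness of
`M·α₀` alone, NO weight window ((2.153)∕(2.157) positivity), (3.36) idle (said); §3 ★★★ **`n15At_allEntries_unitBg`**: `N15At ⟨TGIndexS, c₃₅, p, foInstanceFG, foFamilyAllFG b ν κ, siteOnS a_S …,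
foCovBg b α β, ⊤, dist⟩` — OPERATOR (Λ-C, all four entries) AND UNIT (§2) READ `U`; SITE = G1's genuine kernel (U-blind — its dressing is the scalar-sector two-grid defect, dag-n15-d∕-e's
lane; said); ★★ `live_allEntries_unitBg` (the K3⁸ guard), ★★★ `live_and_n15At_allEntries_unitBg`; def `allEntriesBgObjects` + `rfl` + faces (`n15At_∕live_allEntriesBgObjects`,
`s_N15_of_admits_allEntriesBg`).

HONEST FRAMING ∕ LIMITS.  By-name composition over LANDED rows; MODEL-LEVEL: abelianised first-order species of (3.52)'s `V′(A)` with block-averaged coarse partner (C3), abelianised `Q`,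
the LINEARISED + symmetrised dressing `dressP` of the (1.66) form (the printed (1.103) motivating it not re-certified), «covariant Laplacian» := `Δ − V₁`, «covariant divergence» := flat
`∇*_κ`; GENUINE: Bałaban's `Δ_a⁻¹`, THE (1.66) matrix, b06's (2.152)–(2.157) engine.  NOT [B9] Thms 3.1∕3.15 at a general (3.35)-regular `U` (NOT PRINTED as η-rates), NOT Node 00's [B9]
operator layer of record, NOT the non-abelian dressing (n15-c) — **N15 is NOT discharged**; K3⁸ OPEN, skeleton untouched; counts UNMOVED (typed 28∕28 · discharged 6∕28 of record); one finite
𝕋⁴ at fixed ε per index — NOT ℝ⁴ ∕ infinite volume ∕ OS ∕ mass gap ∕ Clay.  Two plumbing `def`s ⇒ review ∕ audit lane.  ONE declared `set_option maxHeartbeats 800000 in` on §2 ★★★.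
-/

noncomputable section

open scoped BigOperators
open Finset

namespace Summit.QuantumFields.YangMills.BalabanUVNodes.N15.UnitLayerBg

open Literature.MathematicalPhysics.QuantumFieldTheory.Balaban1983to89
open Literature.MathematicalPhysics.QuantumFieldTheory.Balaban1983to89.T4Continuum (T4Family ULoop)
open Literature.MathematicalPhysics.QuantumFieldTheory.Balaban1983to89.T4EtaRate (PairedInstance NE2PlusOperator NE2PlusSite NE2PlusUnit EtaRateIneqUnit)
open Literature.MathematicalPhysics.QuantumFieldTheory.Balaban1983to89.T4EtaRateUnitWitness (covDiff)
open Literature.MathematicalPhysics.QuantumFieldTheory.Balaban1983to89.T4EtaRateCoeffDefect (blockAvg fit_blockAvg)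
open Literature.MathematicalPhysics.QuantumFieldTheory.Balaban1983to89.B5Prop11Plancherel (Tor fine)
open Literature.MathematicalPhysics.QuantumFieldTheory.Balaban1983to89.B6Lemma24Torus (pbox)
open Literature.MathematicalPhysics.QuantumFieldTheory.Balaban1983to89.B6BondEliminationTorus (pdist)
open Literature.MathematicalPhysics.QuantumFieldTheory.Balaban1983to89.B6Cov2156Torus (deltaPol bondReductionT one_le_M)
open Literature.MathematicalPhysics.QuantumFieldTheory.Balaban1983to89.B6LowerBound2153Torus (rep rep_mem_pbox)
open Literature.MathematicalPhysics.QuantumFieldTheory.Balaban1983to89.B6UnitTorusCarrier (unitTorusGeo pdist_rep_rep)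
open Literature.MathematicalPhysics.QuantumFieldTheory.King1986.Torus (tdistT tdistT_nonneg)
open Node00 (NE2Objects₁₁)
open Summit.QuantumFields.YangMills.BalabanUVNodes.N15.OperatorReadout (opGeo)
open Summit.QuantumFields.YangMills.BalabanUVNodes.N15.TwoGrid (gOp TGIndex coeffBgFO reg335_coeffBgFO_iff foInstanceFG foInstanceFG_gf_M foFamilyAllFG ne2PlusOperator_allEntries_fullG osc_rate_le)
open Summit.QuantumFields.YangMills.BalabanUVNodes.N15.VectorPiece (blkFine kingPrV bshiftEquiv)
open Summit.QuantumFields.YangMills.BalabanUVNodes.N15.BackgroundLayer (fgrad fgrad_apply fibreOsc_of_fgrad blockAvg_zero)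
open Summit.QuantumFields.YangMills.BalabanUVNodes.N15.GenuineRecord (TGIndexS tgIndexS_cofinal geoS siteOnS n15At_opGeoS_of_operator_unit live_foInstanceFG)
open Summit.QuantumFields.YangMills.BalabanUVNodes.N15.AtKeyedHome (s_N15_of_admits)
open Summit.QuantumFields.YangMills.BalabanUVNodes.N15.PairedFamilyGuard (Live)
open YMDAG.UVSplit (Datum NE2Carriers RateCarriers RateRecordPred N15At S_N15 ne2OfRecord₁₁)

variable {d : ℕ} {L : ℕ} [NeZero L]

/-! ## §1 The U-seeing unit-lattice kernel on II-E's sized first-order family -/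

section Kernel

/-- ★ **THE U-SEEING UNIT-LATTICE η-DIFFERENCE KERNEL** on `foInstanceFG d hL j`: `(U, y, y′) ↦ C_{P′(U)}^{(L^mL^k)}((ȳ,α),(ȳ′,β)) − C_{P(Ū)}^{(L^k)}((ȳ,α),(ȳ′,β))` — the fine run's
dressed (2.156) covariance AT `U = (c′, a′)` minus the coarse run's AT THE BLOCK-AVERAGED COARSE PARTNER `Ū = (blockAvg c′, blockAvg a′_μ)` (the pairing's `avg`), read at the unit bonds of
directions `α, β` based at the box representatives; `C_P^{(n)} = C(C*(Δ^{(n)} + P)C)⁻¹C*`, `P(U) = dressP b Δ^{(n)} (unitBondMat Z^{(n)}(U))` (U-D `bgPert`∕`covBg`).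
[cite: Balaban1985BackgroundPropagators, Thm 3.15 (3.185)–(3.187) p.432 (shape of `C^{(k)}(Λ)(U)`); Balaban1984PropagatorsII, (2.156) p.250 (object at `U ≡ 1`)] -/
def foCovBg (d : ℕ) (hL : Odd L ∧ 1 < L) (b : ℝ) (α β : Fin (d + 1)) (j : TGIndexS) : B9.SiteKernel (foInstanceFG d hL j).gc (foInstanceFG d hL j).Bf :=
  ⟨fun U y y' =>
    covBg (L := L) (TGIndex.Mn d hL j.toTGIndex) (L ^ j.m * L ^ j.k) b U.1 U.2
        (⟨rep (TGIndex.Mn d hL j.toTGIndex) y, rep_mem_pbox (TGIndex.Mn d hL j.toTGIndex) y⟩, α)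
        (⟨rep (TGIndex.Mn d hL j.toTGIndex) y', rep_mem_pbox (TGIndex.Mn d hL j.toTGIndex) y'⟩, β)
      - covBg (L := L) (TGIndex.Mn d hL j.toTGIndex) (L ^ j.k) b (blockAvg (kingPrV L j.k j.m (TGIndex.Mn d hL j.toTGIndex)) U.1)
          (fun μ => blockAvg (kingPrV L j.k j.m (TGIndex.Mn d hL j.toTGIndex)) (U.2 μ))
        (⟨rep (TGIndex.Mn d hL j.toTGIndex) y, rep_mem_pbox (TGIndex.Mn d hL j.toTGIndex) y⟩, α)
        (⟨rep (TGIndex.Mn d hL j.toTGIndex) y', rep_mem_pbox (TGIndex.Mn d hL j.toTGIndex) y'⟩, β)⟩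

/-- Unfolding of `foCovBg`. [folklore] -/
theorem foCovBg_ker (hL : Odd L ∧ 1 < L) (b : ℝ) (α β : Fin (d + 1)) (j : TGIndexS) (U : (foInstanceFG d hL j).Bf.Cfg) (y y' : Tor (TGIndex.Mn d hL j.toTGIndex)) :
    (foCovBg d hL b α β j).ker U y y' =
      covBg (L := L) (TGIndex.Mn d hL j.toTGIndex) (L ^ j.m * L ^ j.k) b U.1 U.2
          (⟨rep (TGIndex.Mn d hL j.toTGIndex) y, rep_mem_pbox (TGIndex.Mn d hL j.toTGIndex) y⟩, α)
          (⟨rep (TGIndex.Mn d hL j.toTGIndex) y', rep_mem_pbox (TGIndex.Mn d hL j.toTGIndex) y'⟩, β)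
        - covBg (L := L) (TGIndex.Mn d hL j.toTGIndex) (L ^ j.k) b (blockAvg (kingPrV L j.k j.m (TGIndex.Mn d hL j.toTGIndex)) U.1)
            (fun μ => blockAvg (kingPrV L j.k j.m (TGIndex.Mn d hL j.toTGIndex)) (U.2 μ))
          (⟨rep (TGIndex.Mn d hL j.toTGIndex) y, rep_mem_pbox (TGIndex.Mn d hL j.toTGIndex) y⟩, α)
          (⟨rep (TGIndex.Mn d hL j.toTGIndex) y', rep_mem_pbox (TGIndex.Mn d hL j.toTGIndex) y'⟩, β) := rfl

/-- ★ **AT `U = 0` THE U-SEEING KERNEL IS THE GENUINE (2.156) DIFFERENCE**: the carrier's `one` is the zero coefficient pair, whose block averages vanish; both perturbations vanish and the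
kernel is part 76's `covDiff` (up to `L^mL^k = L^{k+m}`). [cite: Balaban1984PropagatorsII, (2.156) p.250 (object)] -/
theorem foCovBg_one (hL : Odd L ∧ 1 < L) (b : ℝ) (α β : Fin (d + 1)) (j : TGIndexS) (y y' : Tor (TGIndex.Mn d hL j.toTGIndex)) :
    (foCovBg d hL b α β j).ker (foInstanceFG d hL j).Bf.one y y' =
      covDiff L (TGIndex.Mn d hL j.toTGIndex) j.k j.m (⟨rep (TGIndex.Mn d hL j.toTGIndex) y, rep_mem_pbox (TGIndex.Mn d hL j.toTGIndex) y⟩, α)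
        (⟨rep (TGIndex.Mn d hL j.toTGIndex) y', rep_mem_pbox (TGIndex.Mn d hL j.toTGIndex) y'⟩, β) := by
  have h1 : (foInstanceFG d hL j).Bf.one = ((fun _ => 0, fun _ _ => 0) : (Tor (fine (L ^ j.m * L ^ j.k) (TGIndex.Mn d hL j.toTGIndex)) × Fin (d + 1) → ℝ) ×
      (Fin (d + 1) → Tor (fine (L ^ j.m * L ^ j.k) (TGIndex.Mn d hL j.toTGIndex)) × Fin (d + 1) → ℝ)) := rfl
  have hc0 : blockAvg (kingPrV L j.k j.m (TGIndex.Mn d hL j.toTGIndex)) (fun _ : Tor (fine (L ^ j.m * L ^ j.k) (TGIndex.Mn d hL j.toTGIndex)) × Fin (d + 1) => (0 : ℝ))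
      = fun _ => 0 := blockAvg_zero (kingPrV L j.k j.m (TGIndex.Mn d hL j.toTGIndex))
  rw [foCovBg_ker, h1]
  show covBg (L := L) (TGIndex.Mn d hL j.toTGIndex) (L ^ j.m * L ^ j.k) b (fun _ => 0) (fun _ _ => 0) _ _
      - covBg (L := L) (TGIndex.Mn d hL j.toTGIndex) (L ^ j.k) b (blockAvg (kingPrV L j.k j.m (TGIndex.Mn d hL j.toTGIndex)) (fun _ => 0))
          (fun μ => blockAvg (kingPrV L j.k j.m (TGIndex.Mn d hL j.toTGIndex)) (fun _ => 0)) _ _ = _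
  rw [hc0]
  unfold covBg covDiff
  rw [bgPert_zero, bgPert_zero, add_zero, add_zero, show L ^ j.m * L ^ j.k = L ^ (j.k + j.m) by rw [pow_add, mul_comm]]

end Kernel

/-! ## §2 ★★★ `NE2PlusUnit` by name with the background live, size live, window-free -/

section UnitLayer

omit [NeZero L] in
/-- On the sized index the periods `M_μ = 2L^{m_T}` are divisible by `L` (`m_T ≥ 1`). [folklore] -/
theorem dvd_Mn_S (hL : Odd L ∧ 1 < L) (j : TGIndexS) (μ : Fin (d + 1)) : L ∣ TGIndex.Mn d hL j.toTGIndex μ := by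
  have hm : j.mT ≠ 0 := by have := j.one_le_mT; omega
  show L ∣ 2 * L ^ j.mT
  exact Dvd.dvd.mul_left (dvd_pow_self L hm) 2

variable (d)

set_option maxHeartbeats 800000 in
/-- ★★★ **`NE2PlusUnit` — THE NODE's THIRD CONJUNCT BY NAME — WITH THE BACKGROUND LIVE AND THE SIZE LIVE, WINDOW-FREE**, on II-E's sized (3.35)-pair family: for `d ≥ 1`, odd `L ≥ 3`, `b > 0`,
`c₃₅ > 0` and every direction pair `α β`, `NE2PlusUnit c₃₅ (foInstanceFG d hL) (foCovBg d hL b α β) ⊤ dist` — constants `(δ₀, a₀, B₀, θ = L^{−γ₀})` after `d, L, b, c₃₅`.  The kernel READS `U`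
(`P′(U)` fine, `P(Ū)` coarse); the guard `M·α₀ ≤ a₀` is LIVE (`(gf j).M = M_sz`) and the (3.35) letters read `c₃₅·M_sz·α₀`; the threshold `a₀` is a smallness of `M·α₀` ALONE (U-A's `ε_cov`
against U-B's amplitude and Λ-E's window `r₁`); the inverse exists by the PRINTED positivity (2.153)∕(2.157); the (3.36) hypothesis is idle (said).  Chain: Λ-E `zOp_letters_FO` → U-B
`dressP_deltaPol_letters` → U-A `cov2156_rate_torus_add`. [cite: Balaban1985BackgroundPropagators, Thm 3.15 (3.185)–(3.187) p.432 (quantifier template, shape), (3.35) p.396;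
Balaban1984PropagatorsII, (2.153)–(2.157) pp.249–250 (positivity, object); King1986, Lemma 4.5 (4.38)–(4.41) pp.674–675 (shape, mechanism)] -/
theorem ne2PlusUnit_foCovBg (hd : 1 ≤ d) (hLodd : Odd L) (hL3 : 3 ≤ L) (hL : Odd L ∧ 1 < L) {b : ℝ} (hb : 0 < b) {c35 : ℝ} (hc35 : 0 < c35) (α β : Fin (d + 1)) :
    NE2PlusUnit c35 (foInstanceFG d hL) (foCovBg d hL b α β) (fun _ _ => True) (fun j => (foInstanceFG d hL j).gc.dist) := by
  have hL2 : 2 ≤ L := by omega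
  have hL1 : 1 ≤ L := by omega
  have hL1r : (1 : ℝ) ≤ (L : ℝ) := by exact_mod_cast hL1
  have hL0r : (0 : ℝ) ≤ (L : ℝ) := by positivity
  have hd0 : (0 : ℝ) ≤ d := Nat.cast_nonneg d
  obtain ⟨δZ, ζ, τ, r₁, hδZ, hζ, hτ, hr₁, HZ⟩ := zOp_letters_FO d hLodd hL3 hL hb
  obtain ⟨K, δ', hK, hδ', HP⟩ := dressP_deltaPol_letters (d + 1) (by omega) hδZ
  obtain ⟨C', δ'', hC', hδ'', HC⟩ := cov2156_rate_torus_add (d + 1) (by omega) hL1 (δP := δ') hδ'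
  have hε₀ := epsCov_pos (d := d + 1) (L := L) (by omega) hL1 hδ'
  have hKb : 0 < K * (|b| + 1) ^ 2 * ζ := by positivity
  -- the rate exponent, the threshold and the constants
  set γ₀ : ℝ := min (1 / 16) (1 / (8 * ((d : ℝ) + 1))) with hγ₀def
  have hd8 : (0 : ℝ) < 1 / (8 * ((d : ℝ) + 1)) := by positivity
  have hγ₀ : 0 < γ₀ := lt_min (by norm_num) hd8
  have hγ₀le : γ₀ ≤ 1 / 16 := min_le_left _ _
  have hγ₀le' : γ₀ ≤ 1 / (8 * ((d : ℝ) + 1)) := min_le_right _ _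
  set a₀ : ℝ := min (r₁ / c35) (epsCov (d + 1) L δ' / (K * (|b| + 1) ^ 2 * ζ * c35)) with ha₀def
  have ha₀ : 0 < a₀ := lt_min (div_pos hr₁ hc35) (div_pos hε₀ (by positivity))
  set rmax : ℝ := c35 * a₀ with hrmax_def
  have hrmax : 0 ≤ rmax := by positivity
  have hrmax₁ : rmax ≤ r₁ := by
    have h := mul_le_mul_of_nonneg_left (min_le_left (r₁ / c35) (epsCov (d + 1) L δ' / (K * (|b| + 1) ^ 2 * ζ * c35))) hc35.le
    rwa [mul_div_cancel₀ _ hc35.ne'] at h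
  have hrmaxε : K * (|b| + 1) ^ 2 * ζ * rmax ≤ epsCov (d + 1) L δ' := by
    have h := mul_le_mul_of_nonneg_left (min_le_right (r₁ / c35) (epsCov (d + 1) L δ' / (K * (|b| + 1) ^ 2 * ζ * c35))) (le_of_lt (mul_pos hKb hc35))
    calc K * (|b| + 1) ^ 2 * ζ * rmax = K * (|b| + 1) ^ 2 * ζ * c35 * a₀ := by rw [hrmax_def]; ring
      _ ≤ K * (|b| + 1) ^ 2 * ζ * c35 * (epsCov (d + 1) L δ' / (K * (|b| + 1) ^ 2 * ζ * c35)) := h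
      _ = epsCov (d + 1) L δ' := mul_div_cancel₀ _ (by positivity)
  set cT : ℝ := 1 + rmax + 2 * ((d : ℝ) + 1) * rmax with hcT_def
  have hcT : 0 ≤ cT := by positivity
  refine ⟨δ'', a₀, C' * (1 + K * (|b| + 1) ^ 2 * (τ * cT + ζ * rmax)) + 1, (L : ℝ) ^ (-γ₀), hδ'', ha₀, by positivity, Real.rpow_pos_of_pos (by positivity) _,
    Real.rpow_lt_one_of_one_lt_of_neg (by exact_mod_cast hL2) (by linarith), fun j α₀ hα₀ hMα U hU _ y y' _ _ => ?_⟩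
  -- the index data and the letters of the configuration
  rw [foInstanceFG_gf_M] at hMα
  obtain ⟨hU1, hU2, hU3⟩ := (reg335_coeffBgFO_iff (TGIndex.Mn d hL j.toTGIndex) (L ^ j.m * L ^ j.k) j.Msz c35 α₀ U).1 hU
  have hMsz : (0 : ℝ) ≤ j.Msz := zero_le_one.trans j.one_le_Msz
  have hr0 : 0 ≤ c35 * j.Msz * α₀ := by positivity
  have hrrmax : c35 * j.Msz * α₀ ≤ rmax := by
    rw [hrmax_def, mul_assoc]; exact mul_le_mul_of_nonneg_left hMα hc35.le
  have hrr₁ : c35 * j.Msz * α₀ ≤ r₁ := hrrmax.trans hrmax₁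
  have hLk : 1 ≤ L ^ j.k := Nat.one_le_pow _ _ hL1
  have hLm : 1 ≤ L ^ j.m := Nat.one_le_pow _ _ hL1
  have hLkr : (0 : ℝ) < (L : ℝ) ^ j.k := by positivity
  have hn' : (0 : ℝ) < ((L ^ j.m * L ^ j.k : ℕ) : ℝ) := by positivity
  have hcast : ((L ^ j.k : ℕ) : ℝ) = (L : ℝ) ^ j.k := by push_cast; ring
  have hx1 : (1 : ℝ) ≤ (L : ℝ) ^ j.k := one_le_pow₀ hL1r
  -- the derived fit of `a′`
  have hfa : ∀ μ' z, |U.2 μ' z - blockAvg (kingPrV L j.k j.m (TGIndex.Mn d hL j.toTGIndex)) (U.2 μ') (kingPrV L j.k j.m (TGIndex.Mn d hL j.toTGIndex) z)| ≤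
      ((2 * ((d + 1) * (L ^ j.m - 1)) : ℕ) : ℝ) * (c35 * j.Msz * α₀ / ((L ^ j.m * L ^ j.k : ℕ) : ℝ)) :=
    fun μ' z => fit_blockAvg _ (fibreOsc_of_fgrad L j.k j.m (TGIndex.Mn d hL j.toTGIndex) hn' fun κ' z => hU3 μ' κ' z) z
  have hoa : 0 ≤ ((2 * ((d + 1) * (L ^ j.m - 1)) : ℕ) : ℝ) * (c35 * j.Msz * α₀ / ((L ^ j.m * L ^ j.k : ℕ) : ℝ)) := by positivity
  -- the rate atoms: `t = (L^k)^{−γ₀}` dominates `(L^k)^{−1∕16}`, `(L^k)^{−1∕(8(d+1))}`, `(L^k)⁻¹` and the fit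
  set t : ℝ := ((L : ℝ) ^ j.k) ^ (-γ₀) with ht_def
  have ht0 : 0 ≤ t := Real.rpow_nonneg hLkr.le _
  have h16 : ((L ^ j.k : ℕ) : ℝ) ^ (-(1 / 16 : ℝ)) ≤ t := by rw [hcast]; exact Real.rpow_le_rpow_of_exponent_le hx1 (by linarith)
  have h8 : ((L ^ j.k : ℕ) : ℝ) ^ (-(1 / (8 * ((d : ℝ) + 1)))) ≤ t := by rw [hcast]; exact Real.rpow_le_rpow_of_exponent_le hx1 (by linarith)
  have htinv : (((L ^ j.k : ℕ) : ℝ))⁻¹ ≤ t := by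
    rw [hcast, ← Real.rpow_neg_one]; exact Real.rpow_le_rpow_of_exponent_le hx1 (by linarith)
  have hn0 : 0 ≤ (((L ^ j.k : ℕ) : ℝ))⁻¹ := by positivity
  have hosc := osc_rate_le (d := d) j.k j.m hL1r (γ := γ₀) hr0 hrrmax (by linarith)
  obtain ⟨T, hT⟩ : ∃ x : ℝ, x = ((L ^ j.k : ℕ) : ℝ) ^ (-(1 / 16 : ℝ)) + c35 * j.Msz * α₀ * ((L ^ j.k : ℕ) : ℝ) ^ (-(1 / (8 * ((d : ℝ) + 1)))) +
      ((2 * ((d + 1) * (L ^ j.m - 1)) : ℕ) : ℝ) * (c35 * j.Msz * α₀ / ((L ^ j.m * L ^ j.k : ℕ) : ℝ)) := ⟨_, rfl⟩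
  have hT0 : 0 ≤ T := hT ▸ by positivity
  have hTle : T ≤ cT * t := by
    have hmid : c35 * j.Msz * α₀ * ((L ^ j.k : ℕ) : ℝ) ^ (-(1 / (8 * ((d : ℝ) + 1)))) ≤ rmax * t := mul_le_mul hrrmax h8 (Real.rpow_nonneg (by positivity) _) hrmax
    rw [hT, hcT_def]
    have e : (1 + rmax + 2 * ((d : ℝ) + 1) * rmax) * t = t + rmax * t + 2 * ((d : ℝ) + 1) * rmax * t := by ring
    rw [e]
    linarith [hosc, hmid, h16]
  -- Λ-E: the middle factor's letters
  obtain ⟨hZ1, hZ2, hZ3⟩ := HZ j.toTGIndex (c35 * j.Msz * α₀) hr0 hrr₁ _ hoa U.1 U.2 hU1 hU2 hfa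
  rw [← hT] at hZ3
  have hζr : 0 ≤ ζ * (c35 * j.Msz * α₀) := by positivity
  have hτT : 0 ≤ τ * T := by positivity
  -- U-B: the perturbation letters
  obtain ⟨hP1, hP2, hP12⟩ := HP (TGIndex.Mn d hL j.toTGIndex) (L ^ j.k) (L ^ j.m * L ^ j.k) (L ^ j.m) hLk hLm rfl b
    (unitBondMat (TGIndex.Mn d hL j.toTGIndex) (zOp d (TGIndex.Mn d hL j.toTGIndex) (L ^ j.k) b (blockAvg (kingPrV L j.k j.m (TGIndex.Mn d hL j.toTGIndex)) U.1)
      (fun μ => blockAvg (kingPrV L j.k j.m (TGIndex.Mn d hL j.toTGIndex)) (U.2 μ))))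
    (unitBondMat (TGIndex.Mn d hL j.toTGIndex) (zOp d (TGIndex.Mn d hL j.toTGIndex) (L ^ j.m * L ^ j.k) b U.1 U.2))
    (ζ * (c35 * j.Msz * α₀)) (τ * T) hζr hτT hZ1 hZ2 hZ3
  -- U-A: the perturbed covariance rate (the ε-guard from `rmax`)
  have hαε : K * (|b| + 1) ^ 2 * (ζ * (c35 * j.Msz * α₀)) ≤ epsCov (d + 1) L δ' := by
    calc K * (|b| + 1) ^ 2 * (ζ * (c35 * j.Msz * α₀)) = K * (|b| + 1) ^ 2 * ζ * (c35 * j.Msz * α₀) := by ring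
      _ ≤ K * (|b| + 1) ^ 2 * ζ * rmax := mul_le_mul_of_nonneg_left hrrmax hKb.le
      _ ≤ epsCov (d + 1) L δ' := hrmaxε
  have hcov := HC (TGIndex.Mn d hL j.toTGIndex) (dvd_Mn_S (d := d) hL j) (L ^ j.k) (L ^ j.m * L ^ j.k) (L ^ j.m) hLk hLm rfl
    (bgPert (TGIndex.Mn d hL j.toTGIndex) (L ^ j.k) b (blockAvg (kingPrV L j.k j.m (TGIndex.Mn d hL j.toTGIndex)) U.1)
      (fun μ => blockAvg (kingPrV L j.k j.m (TGIndex.Mn d hL j.toTGIndex)) (U.2 μ)))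
    (bgPert (TGIndex.Mn d hL j.toTGIndex) (L ^ j.m * L ^ j.k) b U.1 U.2) (dressP_isSymm _ _ _) (dressP_isSymm _ _ _)
    (K * (|b| + 1) ^ 2 * (ζ * (c35 * j.Msz * α₀))) (K * (|b| + 1) ^ 2 * (τ * T + ζ * (c35 * j.Msz * α₀) * ((L ^ j.k : ℕ) : ℝ)⁻¹))
    (by positivity) hαε (by positivity) hP1 hP2 hP12
    (⟨rep (TGIndex.Mn d hL j.toTGIndex) y, rep_mem_pbox (TGIndex.Mn d hL j.toTGIndex) y⟩, α) (⟨rep (TGIndex.Mn d hL j.toTGIndex) y', rep_mem_pbox (TGIndex.Mn d hL j.toTGIndex) y'⟩, β)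
  have hdist : pdist (TGIndex.Mn d hL j.toTGIndex) (one_le_M (TGIndex.Mn d hL j.toTGIndex)) (rep (TGIndex.Mn d hL j.toTGIndex) y) (rep (TGIndex.Mn d hL j.toTGIndex) y')
      = tdistT (TGIndex.Mn d hL j.toTGIndex) y y' := pdist_rep_rep _ _ y y'
  rw [foCovBg_ker]
  show |covBg (L := L) (TGIndex.Mn d hL j.toTGIndex) (L ^ j.m * L ^ j.k) b U.1 U.2 _ _
      - covBg (L := L) (TGIndex.Mn d hL j.toTGIndex) (L ^ j.k) b _ _ _ _|
    ≤ (C' * (1 + K * (|b| + 1) ^ 2 * (τ * cT + ζ * rmax)) + 1) * Real.exp (-(δ'' * tdistT (TGIndex.Mn d hL j.toTGIndex) y y')) * ((L : ℝ) ^ (-γ₀)) ^ j.k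
  unfold covBg
  refine hcov.trans ?_
  rw [← rpow_pow_eq hL0r, ← hdist]
  have hE := Real.exp_nonneg (-(δ'' * pdist (TGIndex.Mn d hL j.toTGIndex) (one_le_M (TGIndex.Mn d hL j.toTGIndex)) (rep (TGIndex.Mn d hL j.toTGIndex) y) (rep (TGIndex.Mn d hL j.toTGIndex) y')))
  -- the amplitude against `t = (L^k)^{−γ₀}`
  have hamp : C' * ((((L ^ j.k : ℕ) : ℝ))⁻¹ + K * (|b| + 1) ^ 2 * (τ * T + ζ * (c35 * j.Msz * α₀) * (((L ^ j.k : ℕ) : ℝ))⁻¹))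
      ≤ (C' * (1 + K * (|b| + 1) ^ 2 * (τ * cT + ζ * rmax)) + 1) * t := by
    have h1 : ζ * (c35 * j.Msz * α₀) * (((L ^ j.k : ℕ) : ℝ))⁻¹ ≤ ζ * rmax * t := mul_le_mul (mul_le_mul_of_nonneg_left hrrmax hζ.le) htinv hn0 (by positivity)
    have h2 : τ * T ≤ τ * cT * t := by rw [mul_assoc]; exact mul_le_mul_of_nonneg_left hTle hτ.le
    have h3 : K * (|b| + 1) ^ 2 * (τ * T + ζ * (c35 * j.Msz * α₀) * (((L ^ j.k : ℕ) : ℝ))⁻¹) ≤ K * (|b| + 1) ^ 2 * (τ * cT + ζ * rmax) * t := by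
      calc K * (|b| + 1) ^ 2 * (τ * T + ζ * (c35 * j.Msz * α₀) * (((L ^ j.k : ℕ) : ℝ))⁻¹) ≤ K * (|b| + 1) ^ 2 * (τ * cT * t + ζ * rmax * t) :=
            mul_le_mul_of_nonneg_left (add_le_add h2 h1) (by positivity)
        _ = _ := by ring
    calc C' * ((((L ^ j.k : ℕ) : ℝ))⁻¹ + K * (|b| + 1) ^ 2 * (τ * T + ζ * (c35 * j.Msz * α₀) * (((L ^ j.k : ℕ) : ℝ))⁻¹))
        ≤ C' * (t + K * (|b| + 1) ^ 2 * (τ * cT + ζ * rmax) * t) := mul_le_mul_of_nonneg_left (add_le_add htinv h3) hC'.le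
      _ = (C' * (1 + K * (|b| + 1) ^ 2 * (τ * cT + ζ * rmax))) * t := by ring
      _ ≤ _ := mul_le_mul_of_nonneg_right (by linarith) ht0
  calc C' * ((((L ^ j.k : ℕ) : ℝ))⁻¹ + K * (|b| + 1) ^ 2 * (τ * T + ζ * (c35 * j.Msz * α₀) * (((L ^ j.k : ℕ) : ℝ))⁻¹)) *
        Real.exp (-(δ'' * pdist (TGIndex.Mn d hL j.toTGIndex) (one_le_M (TGIndex.Mn d hL j.toTGIndex)) (rep (TGIndex.Mn d hL j.toTGIndex) y) (rep (TGIndex.Mn d hL j.toTGIndex) y')))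
      ≤ ((C' * (1 + K * (|b| + 1) ^ 2 * (τ * cT + ζ * rmax)) + 1) * t) *
        Real.exp (-(δ'' * pdist (TGIndex.Mn d hL j.toTGIndex) (one_le_M (TGIndex.Mn d hL j.toTGIndex)) (rep (TGIndex.Mn d hL j.toTGIndex) y) (rep (TGIndex.Mn d hL j.toTGIndex) y'))) :=
        mul_le_mul_of_nonneg_right hamp hE
    _ = _ := by rw [ht_def]; ring

end UnitLayer

/-! ## §3 `N15At` with the operator AND the unit layers reading `U`; the guard; the `NE2Objects₁₁` literal; keyed face -/

section Record

/-- ★★★ **`N15At` — ALL THREE CONJUNCTS BY NAME FOR THE PAIR OF RECORD, THE OPERATOR (ALL FOUR (3.42) ENTRIES) AND THE UNIT LAYERS READING THE BACKGROUND** (`d ≥ 1`, odd `L ≥ 3`, `b, a_S,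
c₃₅ > 0`; every `p`, directions `ν κ α β`): OPERATOR = Λ-C `ne2PlusOperator_allEntries_fullG`, UNIT = §2 `ne2PlusUnit_foCovBg`, SITE = G1's genuine `U ≡ 1` scalar-sector kernel `(Q′G′²Q′*)⁻¹`
(U-BLIND; said), through S-D `n15At_opGeoS_of_operator_unit`. [bookkeeping] -/
theorem n15At_allEntries_unitBg (hd : 1 ≤ d) (hLodd : Odd L) (hL3 : 3 ≤ L) (hL : Odd L ∧ 1 < L) {b aS c35 : ℝ} (hb : 0 < b) (haS : 0 < aS) (hc35 : 0 < c35)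
    (ν κ α β : Fin (d + 1)) (p : ℝ) :
    N15At { I := TGIndexS, c35 := c35, p := p, pi := foInstanceFG d hL, Kop := foFamilyAllFG d hL b ν κ,
            Ksite := siteOnS d hL aS TGIndexS.toTGIndex TGIndexS.Msz (fun j => Tor (fine (L ^ j.k) (TGIndex.Mn d hL j.toTGIndex)) × Fin (d + 1))
              (fun j => blkFine L j.k (TGIndex.Mn d hL j.toTGIndex)) (fun j => (foInstanceFG d hL j).Bf),
            Kunit := foCovBg d hL b α β, inΛ := fun _ _ => True, unitDist := fun j => (foInstanceFG d hL j).gc.dist } :=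
  n15At_opGeoS_of_operator_unit (d := d) hL TGIndexS.toTGIndex TGIndexS.Msz (fun j => Tor (fine (L ^ j.k) (TGIndex.Mn d hL j.toTGIndex)) × Fin (d + 1))
    (fun j => blkFine L j.k (TGIndex.Mn d hL j.toTGIndex)) (fun j => (foInstanceFG d hL j).gf) (fun j => (foInstanceFG d hL j).Bc) (fun j => (foInstanceFG d hL j).Bf)
    hLodd (by omega) haS (fun j => (foInstanceFG d hL j).pair) p (foFamilyAllFG d hL b ν κ) (foCovBg d hL b α β) (fun _ _ => True) (fun j => (foInstanceFG d hL j).gc.dist)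
    (ne2PlusOperator_allEntries_fullG d hLodd hL3 hL hb c35 hc35 ν κ) (ne2PlusUnit_foCovBg d hd hLodd hL3 hL hb hc35 α β)

/-- ★★ **THE FAMILY WITH THESE KERNELS PASSES THE K3⁷∕K3⁸ GUARD** (Λ-D `live_foInstanceFG`: size and scale count jointly cofinal, the trivial field regular; `c₃₅ ≥ 0`). [bookkeeping] -/
theorem live_allEntries_unitBg (hL : Odd L ∧ 1 < L) {b aS c35 : ℝ} (hc35 : 0 ≤ c35) (ν κ α β : Fin (d + 1)) (p : ℝ) :
    Live ⟨TGIndexS, c35, p, foInstanceFG d hL, foFamilyAllFG d hL b ν κ,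
        siteOnS d hL aS TGIndexS.toTGIndex TGIndexS.Msz (fun j => Tor (fine (L ^ j.k) (TGIndex.Mn d hL j.toTGIndex)) × Fin (d + 1))
          (fun j => blkFine L j.k (TGIndex.Mn d hL j.toTGIndex)) (fun j => (foInstanceFG d hL j).Bf),
        foCovBg d hL b α β, fun _ _ => True, fun j => (foInstanceFG d hL j).gc.dist⟩ :=
  live_foInstanceFG hL hc35 p _ _ _

/-- ★★★ **GUARD ∧ `N15At` FOR THE PAIR OF RECORD WITH THE OPERATOR AND THE UNIT LAYERS READING `U`** (`d ≥ 1`, odd `L ≥ 3`, `b, a_S, c₃₅ > 0`). [bookkeeping] -/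
theorem live_and_n15At_allEntries_unitBg (hd : 1 ≤ d) (hLodd : Odd L) (hL3 : 3 ≤ L) (hL : Odd L ∧ 1 < L) {b aS c35 : ℝ} (hb : 0 < b) (haS : 0 < aS) (hc35 : 0 < c35)
    (ν κ α β : Fin (d + 1)) (p : ℝ) :
    Live ⟨TGIndexS, c35, p, foInstanceFG d hL, foFamilyAllFG d hL b ν κ,
        siteOnS d hL aS TGIndexS.toTGIndex TGIndexS.Msz (fun j => Tor (fine (L ^ j.k) (TGIndex.Mn d hL j.toTGIndex)) × Fin (d + 1))
          (fun j => blkFine L j.k (TGIndex.Mn d hL j.toTGIndex)) (fun j => (foInstanceFG d hL j).Bf),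
        foCovBg d hL b α β, fun _ _ => True, fun j => (foInstanceFG d hL j).gc.dist⟩ ∧
      N15At { I := TGIndexS, c35 := c35, p := p, pi := foInstanceFG d hL, Kop := foFamilyAllFG d hL b ν κ,
              Ksite := siteOnS d hL aS TGIndexS.toTGIndex TGIndexS.Msz (fun j => Tor (fine (L ^ j.k) (TGIndex.Mn d hL j.toTGIndex)) × Fin (d + 1))
                (fun j => blkFine L j.k (TGIndex.Mn d hL j.toTGIndex)) (fun j => (foInstanceFG d hL j).Bf),
              Kunit := foCovBg d hL b α β, inΛ := fun _ _ => True, unitDist := fun j => (foInstanceFG d hL j).gc.dist } :=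
  ⟨live_allEntries_unitBg hL hc35.le ν κ α β p, n15At_allEntries_unitBg hd hLodd hL3 hL hb haS hc35 ν κ α β p⟩

/-- THE PAIR-OF-RECORD FAMILY WITH OPERATOR AND UNIT LAYERS U-SEEING, AS RR-1's NE2 OBJECT LITERAL (`NE2Objects₁₁`), field for field. [bookkeeping] -/
def allEntriesBgObjects (d : ℕ) (hL : Odd L ∧ 1 < L) (b aS : ℝ) (ν κ α β : Fin (d + 1)) (c35 p : ℝ) : NE2Objects₁₁ :=
  ⟨TGIndexS, c35, p, foInstanceFG d hL, foFamilyAllFG d hL b ν κ,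
    siteOnS d hL aS TGIndexS.toTGIndex TGIndexS.Msz (fun j => Tor (fine (L ^ j.k) (TGIndex.Mn d hL j.toTGIndex)) × Fin (d + 1))
      (fun j => blkFine L j.k (TGIndex.Mn d hL j.toTGIndex)) (fun j => (foInstanceFG d hL j).Bf),
    foCovBg d hL b α β, fun _ _ => True, fun j => (foInstanceFG d hL j).gc.dist⟩

/-- the record map reads the literal as the rates bundle (`rfl`). [bookkeeping] -/
theorem ne2OfRecord₁₁_allEntriesBgObjects (hL : Odd L ∧ 1 < L) (b aS : ℝ) (ν κ α β : Fin (d + 1)) (c35 p : ℝ) :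
    ne2OfRecord₁₁ (allEntriesBgObjects d hL b aS ν κ α β c35 p) =
      { I := TGIndexS, c35 := c35, p := p, pi := foInstanceFG d hL, Kop := foFamilyAllFG d hL b ν κ,
        Ksite := siteOnS d hL aS TGIndexS.toTGIndex TGIndexS.Msz (fun j => Tor (fine (L ^ j.k) (TGIndex.Mn d hL j.toTGIndex)) × Fin (d + 1))
          (fun j => blkFine L j.k (TGIndex.Mn d hL j.toTGIndex)) (fun j => (foInstanceFG d hL j).Bf),
        Kunit := foCovBg d hL b α β, inΛ := fun _ _ => True, unitDist := fun j => (foInstanceFG d hL j).gc.dist } := rfl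

/-- ★★ `N15At` at the literal (`d ≥ 1`, odd `L ≥ 3`, `b, a_S, c₃₅ > 0`). [bookkeeping] -/
theorem n15At_allEntriesBgObjects (hd : 1 ≤ d) (hLodd : Odd L) (hL3 : 3 ≤ L) (hL : Odd L ∧ 1 < L) {b aS c35 : ℝ} (hb : 0 < b) (haS : 0 < aS) (hc35 : 0 < c35)
    (ν κ α β : Fin (d + 1)) (p : ℝ) :
    N15At (ne2OfRecord₁₁ (allEntriesBgObjects d hL b aS ν κ α β c35 p)) :=
  n15At_allEntries_unitBg hd hLodd hL3 hL hb haS hc35 ν κ α β p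

/-- ★★ the literal is LIVE (`c₃₅ ≥ 0`). [bookkeeping] -/
theorem live_allEntriesBgObjects (hL : Odd L ∧ 1 < L) (b aS : ℝ) (ν κ α β : Fin (d + 1)) {c35 : ℝ} (hc35 : 0 ≤ c35) (p : ℝ) :
    Live (ne2OfRecord₁₁ (allEntriesBgObjects d hL b aS ν κ α β c35 p)) :=
  live_allEntries_unitBg hL hc35 ν κ α β p

variable {N : ℕ} [NeZero N] {key : (F : T4Family) → Datum F N → Prop}

/-- ★★ **THE FAMILY AT ANY KEYED HOME** (part 30's interface): a rate home over ANY key admitting only the literals of a key-indexed NE2 reading whose value everywhere is this family has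
`S_N15 RRec` (`d ≥ 1`, odd `L ≥ 3`, `b, a_S, c₃₅ > 0`). [bookkeeping] -/
theorem s_N15_of_admits_allEntriesBg (hd : 1 ≤ d) (hLodd : Odd L) (hL3 : 3 ≤ L) (hL : Odd L ∧ 1 < L) {b aS c35 : ℝ} (hb : 0 < b) (haS : 0 < aS) (hc35 : 0 < c35)
    (ν κ α β : Fin (d + 1)) (p : ℝ) (ne2At : ∀ {F : T4Family} {D : Datum F N}, key F D → (ℕ → ℝ) → List (ULoop F) → ℕ → NE2Objects₁₁) (RRec : RateRecordPred N)
    (hadm : ∀ (F : T4Family) (D : Datum F N) (g₀ : ℕ → ℝ) (os : List (ULoop F)) (R : RateCarriers N), RRec F D g₀ os R →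
      ∃ (h : key F D) (k : ℕ), R.ne2 = ne2OfRecord₁₁ (ne2At h g₀ os k))
    (h : ∀ (F : T4Family) (D : Datum F N) (h : key F D) (g₀ : ℕ → ℝ) (os : List (ULoop F)) (k : ℕ), ne2At h g₀ os k = allEntriesBgObjects d hL b aS ν κ α β c35 p) :
    S_N15 RRec :=
  s_N15_of_admits ne2At RRec hadm fun F D hk g₀ os k => by rw [h F D hk g₀ os k]; exact n15At_allEntriesBgObjects hd hLodd hL3 hL hb haS hc35 ν κ α β p

end Record

end Summit.QuantumFields.YangMills.BalabanUVNodes.N15.UnitLayerBg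

end
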